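import Literature.AlgebraicGeometry.AbelianSchemes.PoincareUniversalLocality
import Literature.AlgebraicGeometry.AbelianVarieties.PoincareSheafOfPrincipal
import Literature.AlgebraicGeometry.Modules.PullbackFrame
import HarnessLib

/-!
# The rigidified gluing property from class-level triviality on `A_T`

Layer `Literature/AlgebraicGeometry/AbelianSchemes`, namespace `Literature.AlgebraicGeometry.AbelianSchemes`.
Setting as in `AbelianSchemes/PoincareUniversalLocality`: abelian schemes `A, B / S`, a module `𝒫` on `A ×_S B`,
a test datum `(f : T → S, ℒ)` and an `S`-morphism `g : T → B`.

For `𝒫` of rank one, `(1_A × g)^* 𝒫` and `ℒ.L` are rank-one modules on `A_T`; they are isomorphic iff the class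
`[M]·[N]⁻¹ ∈ Ȟ¹(A_T, 𝒪^×)` of their determinant cocycles is trivial (`nonempty_iso_iff_detClass_eq`,
`AbelianVarieties/PoincareSheafOfPrincipal`); local isomorphisms on the members `A_{U_i}` of an open cover of `T`
say that this class dies on every `A_{U_i}` (`detClass_pullback`, `Modules/PullbackFrame`), and the two
rigidifications (that of `𝒫` along `ε_A × 1_B`, `unitSection_comp_baseChangeToProd`, and that of `ℒ`) say that it
dies along the zero section `ε_T` (`detClass_unitModule_eq_one`).  Hence:

* **`rigidifiedGluing_of_cechPic`** — the rigidified gluing property `RigidifiedGluing A B 𝒫` follows from the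
  purely Čech statement «a class in `CechPic A_T` that pulls back to `1` on every `A_{U_i}` and along `ε_T` is `1`».

This is the form in which [MumfordAV1970, §13, proof of the Thm. p. 125] uses the rigidification: normalised
isomorphisms are unique, so local ones glue ([MumfordAV1970, §5 Cor. 6]).  Everything is proved; no named facts.

## References
* [MumfordAV1970] D. Mumford, *Abelian Varieties* (1970), §13 (proof of the Thm. p. 125), §5 Cor. 6 (p. 54).
* [MumfordFogartyKirwan1994] D. Mumford, J. Fogarty, F. Kirwan, *Geometric Invariant Theory*, 3rd ed. (1994), Ch. 6 §2 (p. 121).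
* [Hartshorne1977] R. Hartshorne, *Algebraic Geometry*, GTM 52 (1977), III Ex. 4.5.
-/

universe u

open CategoryTheory CategoryTheory.Limits AlgebraicGeometry MonoidalCategory

noncomputable section

-- `Scheme.Modules` / `SheafOfModules` are not reducible (as in Mathlib's `AlgebraicGeometry/Modules/Sheaf.lean`).
set_option backward.isDefEq.respectTransparency false

namespace Literature.AlgebraicGeometry.AbelianSchemes

open Literature.AlgebraicGeometry.Motives Literature.AlgebraicGeometry.AbelianVarieties
  Literature.AlgebraicGeometry.Modules

namespace AbelianSchemeOver

variable {S : Scheme.{u}} (A : AbelianSchemeOver S)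

section ClassReduction

variable (B : AbelianSchemeOver S) (P : (A.prodLeft B).Modules)

/-- The identity section and `1_A × g`: `ε_T ≫ (1_A × g) = g ≫ (ε_A × 1_B)`. [cite: MumfordFogartyKirwan1994, Ch. 6 §2 (p. 121)] -/
@[reassoc]
theorem unitSection_comp_baseChangeToProd {T : Scheme.{u}} (f : T ⟶ S) (g : T ⟶ B.X.left)
    (hg : g ≫ B.X.hom = f) :
    (A.baseChange f).unitSection ≫ A.baseChangeToProd B f g hg = g ≫ A.unitSlice B := by
  have h₁ : (A.baseChange f).unitSection ≫ pullback.snd A.X.hom f = 𝟙 _ := (A.baseChange f).unitSection_comp_hom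
  apply pullback.hom_ext
  · rw [Category.assoc, baseChangeToProd_fst, unitSection_baseChange_comp_fst, Category.assoc, unitSlice_fst,
      ← Category.assoc, hg]
  · rw [Category.assoc, baseChangeToProd_snd, ← Category.assoc, h₁, Category.id_comp, Category.assoc, unitSlice_snd,
      Category.comp_id]

/-- `ε_T^* (1_A × g)^* 𝒫 ≅ 𝒪_T` when `𝒫` is rigidified along `ε_A × 1_B`. [cite: MumfordFogartyKirwan1994, Ch. 6 §2 (p. 121)] -/
theorem nonempty_pullback_unitSection_baseChangeToProd_iso {T : Scheme.{u}} (f : T ⟶ S) (g : T ⟶ B.X.left)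
    (hg : g ≫ B.X.hom = f)
    (hP : Nonempty ((Scheme.Modules.pullback (A.unitSlice B)).obj P ≅ SheafOfModules.unit _)) :
    Nonempty ((Scheme.Modules.pullback (A.baseChange f).unitSection).obj
      ((Scheme.Modules.pullback (A.baseChangeToProd B f g hg)).obj P) ≅ SheafOfModules.unit _) :=
  hP.map fun r =>
    (Scheme.Modules.pullbackComp _ _).app P ≪≫
      (Scheme.Modules.pullbackCongr (A.unitSection_comp_baseChangeToProd B f g hg)).app P ≪≫
      ((Scheme.Modules.pullbackComp _ _).app P).symm ≪≫
      (Scheme.Modules.pullback g).mapIso r ≪≫ RigidifiedLineBundle.pullbackUnitIso g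

/-- **The rigidified gluing property follows from class-level triviality** «a Čech class on `A_T` that dies on
every `A_{U_i}` (`U_i` an open cover of `T`) and along `ε_T` is trivial», for `𝒫` of rank one.
[cite: MumfordAV1970, §13 (proof of the Thm. p. 125) with §5 Cor. 6 (p. 54)] [cite: Hartshorne1977, III Ex. 4.5] -/
theorem rigidifiedGluing_of_cechPic (hP1 : HasRank P 1)
    (hkey : ∀ {T : Scheme.{u}} (f : T ⟶ S) (𝒰 : Scheme.OpenCover.{u} T) (c : CechPic (A.baseChange f).X.left),
      (∀ i, CechPic.pullback (A.prodMap (𝒰.f i ≫ f) f (𝒰.f i) rfl) c = 1) →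
      CechPic.pullback (A.baseChange f).unitSection c = 1 → c = 1) :
    A.RigidifiedGluing B P := by
  intro hP T f ℒ g hg 𝒰 hloc
  -- read `(1_A × g)^* 𝒫` as a module on `(A.baseChange f).X.left` (= `pullback A.X.hom f` definitionally)
  let M : (A.baseChange f).X.left.Modules := (Scheme.Modules.pullback (A.baseChangeToProd B f g hg)).obj P
  have hM : HasRank M 1 := hasRank_pullback _ hP1
  change Nonempty (M ≅ ℒ.L)
  have hN : HasRank ℒ.L 1 := ℒ.hasRank_one
  have hMf := HasRank.isFiniteLocallyFree' hM
  have hNf := HasRank.isFiniteLocallyFree' hN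
  refine (nonempty_iso_iff_detClass_eq hM hN hMf hNf).2 ?_
  suffices h : detClass hMf * (detClass hNf)⁻¹ = 1 from mul_inv_eq_one.mp h
  apply hkey f 𝒰
  · intro i
    obtain ⟨φ⟩ := hloc i
    have e := detClass_eq_of_iso φ (hMf.pullback (A.prodMap (𝒰.f i ≫ f) f (𝒰.f i) rfl))
      (hNf.pullback (A.prodMap (𝒰.f i ≫ f) f (𝒰.f i) rfl))
    have e' : CechPic.pullback (A.prodMap (𝒰.f i ≫ f) f (𝒰.f i) rfl) (detClass hMf) =
        CechPic.pullback (A.prodMap (𝒰.f i ≫ f) f (𝒰.f i) rfl) (detClass hNf) :=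
      (detClass_pullback (A.prodMap (𝒰.f i ≫ f) f (𝒰.f i) rfl) hMf).symm.trans
        (e.trans (detClass_pullback (A.prodMap (𝒰.f i ≫ f) f (𝒰.f i) rfl) hNf))
    rw [map_mul, map_inv, e', mul_inv_cancel]
  · obtain ⟨rM⟩ := A.nonempty_pullback_unitSection_baseChangeToProd_iso B P f g hg hP
    obtain ⟨rN⟩ := ℒ.rigid
    have h1 : CechPic.pullback (A.baseChange f).unitSection (detClass hMf) = 1 := by
      rw [← detClass_pullback]
      exact (detClass_eq_of_iso rM _ (HasRank.isFiniteLocallyFree' hasRank_unitModule)).trans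
        (detClass_unitModule_eq_one _)
    have h2 : CechPic.pullback (A.baseChange f).unitSection (detClass hNf) = 1 := by
      rw [← detClass_pullback]
      exact (detClass_eq_of_iso rN _ (HasRank.isFiniteLocallyFree' hasRank_unitModule)).trans
        (detClass_unitModule_eq_one _)
    rw [map_mul, map_inv, h1, h2, inv_one, mul_one]

end ClassReduction

end AbelianSchemeOver

end Literature.AlgebraicGeometry.AbelianSchemes

end
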